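import Literature.MathematicalPhysics.QuantumFieldTheory.OSTimeTubeSmearedRotation
import HarnessLib

/-!
# The infinitesimal rotation identity of an OS time continuation on the complex time tube

Support file (everything proved; no definitions, no named facts) for (B)
`Literature.MathematicalPhysics.QuantumFieldTheory.OS1973_lorentzInvariant_of_timeContinuation`
(`OSTimeContinuation`; Osterwalder–Schrader I (1973), §4.2, (4.14)–(4.17)). The sequel of
`OSTimeTubeSmearedRotation`: there the infinitesimal Euclidean rotation invariance (E1, OS I
(4.15)) of an OS time continuation `𝔚` was brought into the smeared pointwise form

  `∑ₖ ( i ∂ₖ K_{y_k^j ψ}(iu) + u_k K_{∂_{k,j}ψ}(iu) ) = 0`    (`u` ordered positive times),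

`K_χ(w) = ∫ 𝔚 (tsCfg w y) χ(y) dy`. The left side is the value at `w = iu` of the function

  `Ψ(w) = ∑ₖ ( i ∂ₖ K_{y_k^j ψ}(w) − i w_k K_{∂_{k,j}ψ}(w) )`,

which is holomorphic on the complex time tube `𝒯ₙ` (`OSTimeTubeDerivatives`); by the identity
theorem from imaginary points (`eqOn_zero_cTimeTube_of_imagTimes`, `OSTimeTubeCoordinates`) it
vanishes on all of `𝒯ₙ`. This is the analytic continuation "in the time variables" by which
Osterwalder–Schrader pass from the Euclidean rotations to the Lorentz boosts ((4.16)–(4.17): the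
generator `Y_{0j}` of rotations becomes the generator `X_{0j}` of boosts), here on the time tube and
in position space:

* `sum_fderiv_smearing_eq_sum_mul_smearing` — for every `w ∈ 𝒯ₙ`,
  `∑ₖ ∂ₖ K_{y_k^j ψ}(w) = ∑ₖ w_k K_{∂_{k,j}ψ}(w)`.

## References

* K. Osterwalder, R. Schrader, *Axioms for Euclidean Green's functions*, Comm. Math. Phys. 31
  (1973) 83–112, §4.2, (4.14)–(4.17). [OsterwalderSchraderCMP1973]
* K. Osterwalder, R. Schrader, *Axioms for Euclidean Green's functions II*, Comm. Math. Phys. 42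
  (1975) 281–305, §IV.2 p. 288. [OsterwalderSchraderCMP1975]
-/

noncomputable section

open Filter Complex Set MeasureTheory Metric
open scoped Topology SchwartzMap ContDiff
open Literature.MathematicalPhysics.QuantumLattice

namespace Literature.MathematicalPhysics.QuantumFieldTheory

variable {d n : ℕ} {S : SchwingerFamily (EuclideanSpace ℝ (Fin (d + 1)))}
  {𝔚 : (Fin n → Fin (d + 1) → ℂ) → ℂ}

/-- **The infinitesimal rotation identity on the complex time tube** (Osterwalder–Schrader I
(1973), §4.2: the analytic continuation in the times of `Y_{0j} Sₙ = 0`): if `𝔖ₙ` is Euclidean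
covariant and `𝔚` is continuous on the time tube, holomorphic in the times, with Euclidean
restriction `𝔖ₙ` on time-ordered test functions, then for every smooth compactly supported
spatial test function `ψ`, every spatial direction `j` and every `w ∈ 𝒯ₙ`,
`∑ₖ ∂ₖ K_{y_k^j ψ}(w) = ∑ₖ w_k K_{∂_{k,j}ψ}(w)`, `K_χ(w) = ∫ 𝔚 (tsCfg w y) χ(y) dy`. [cite: OsterwalderSchraderCMP1973, §4.2 eqs. (4.14)–(4.17)] -/
theorem sum_fderiv_smearing_eq_sum_mul_smearing (hE1 : S.IsEuclideanCovariant)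
    (hc : ContinuousOn 𝔚 (timeTube d n)) (hh : IsTimeHolomorphicOn 𝔚 (timeTube d n))
    (hS : ∀ F : 𝓢((Fin n → EuclideanSpace ℝ (Fin (d + 1))), ℂ), IsTimeOrdered F →
      S n F = ∫ x, 𝔚 (euclideanPoint x) * F x)
    (j : Fin d) {ψ : (Fin n → EuclideanSpace ℝ (Fin d)) → ℂ} (hψ : ContDiff ℝ ∞ ψ)
    (hψc : HasCompactSupport ψ) {w : Fin n → ℂ} (hw : w ∈ cTimeTube n) :
    ∑ k, fderiv ℂ (fun w => ∫ y, 𝔚 (tsCfg w y) * (((y k j : ℝ) : ℂ) * ψ y)) w (Pi.single k 1) =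
      ∑ k, w k * ∫ y, 𝔚 (tsCfg w y) *
        fderiv ℝ ψ y (Pi.single k (EuclideanSpace.single j (1 : ℝ))) := by
  -- the spatial test functions
  have hχ : ∀ k : Fin n, Continuous fun y : Fin n → EuclideanSpace ℝ (Fin d) =>
      ((y k j : ℝ) : ℂ) * ψ y := fun k =>
    (continuous_ofReal.comp ((EuclideanSpace.proj j).continuous.comp (continuous_apply k))).mul
      hψ.continuous
  have hχc : ∀ k : Fin n, HasCompactSupport fun y : Fin n → EuclideanSpace ℝ (Fin d) =>
      ((y k j : ℝ) : ℂ) * ψ y := fun k => hψc.mul_left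
  have hψ' : ∀ k : Fin n, Continuous fun y : Fin n → EuclideanSpace ℝ (Fin d) =>
      fderiv ℝ ψ y (Pi.single k (EuclideanSpace.single j (1 : ℝ))) := fun k =>
    (hψ.continuous_fderiv (by simp)).clm_apply continuous_const
  have hψ'c : ∀ k : Fin n, HasCompactSupport fun y : Fin n → EuclideanSpace ℝ (Fin d) =>
      fderiv ℝ ψ y (Pi.single k (EuclideanSpace.single j (1 : ℝ))) := fun k => hψc.fderiv_apply ℝ _
  -- the holomorphic function `Ψ`
  set Ψ : (Fin n → ℂ) → ℂ := fun w =>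
    ∑ k, (I * fderiv ℂ (fun w => ∫ y, 𝔚 (tsCfg w y) * (((y k j : ℝ) : ℂ) * ψ y)) w (Pi.single k 1) +
      (-I * w k) * ∫ y, 𝔚 (tsCfg w y) *
        fderiv ℝ ψ y (Pi.single k (EuclideanSpace.single j (1 : ℝ)))) with hΨ
  have hKd : ∀ k : Fin n, DifferentiableOn ℂ (fun w =>
      fderiv ℂ (fun w => ∫ y, 𝔚 (tsCfg w y) * (((y k j : ℝ) : ℂ) * ψ y)) w (Pi.single k 1))
      (cTimeTube n) := fun k =>
    Literature.Analysis.Complex.SCV.differentiableOn_fderiv_apply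
      (differentiableOn_integral_tsCfg_mul hc hh (hχ k) (hχc k)) isOpen_cTimeTube _
  have hHd : ∀ k : Fin n, DifferentiableOn ℂ (fun w => ∫ y, 𝔚 (tsCfg w y) *
      fderiv ℝ ψ y (Pi.single k (EuclideanSpace.single j (1 : ℝ)))) (cTimeTube n) := fun k =>
    differentiableOn_integral_tsCfg_mul hc hh (hψ' k) (hψ'c k)
  have hΨd : DifferentiableOn ℂ Ψ (cTimeTube n) := by
    refine DifferentiableOn.fun_sum fun k _ => ((hKd k).const_mul I).add ?_
    exact ((differentiableOn_const (-I)).mul (differentiable_apply (𝕜 := ℂ) k).differentiableOn).mul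
      (hHd k)
  -- `Ψ` vanishes at imaginary ordered times: `OSTimeTubeSmearedRotation`
  have hΨ0 : ∀ u ∈ orderedTimes n, Ψ (imagTimes u) = 0 := by
    intro u hu
    have h := sum_rotGen_smearing_imagTimes_eq_zero hE1 hc hh hS j hψ hψc hu
    have hcoef : ∀ k, -I * imagTimes u k = ((u k : ℝ) : ℂ) := fun k => by
      rw [imagTimes_apply, ← mul_assoc, show -I * I = 1 by rw [neg_mul, I_mul_I, neg_neg], one_mul]
    simp only [hΨ, hcoef]
    exact h
  -- hence on the whole complex time tube
  have hΨw : Ψ w = 0 := eqOn_zero_cTimeTube_of_imagTimes hΨd hΨ0 hw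
  have hΨw' : Ψ w = I * ((∑ k, fderiv ℂ (fun w => ∫ y, 𝔚 (tsCfg w y) * (((y k j : ℝ) : ℂ) * ψ y)) w
      (Pi.single k 1)) - ∑ k, w k * ∫ y, 𝔚 (tsCfg w y) *
        fderiv ℝ ψ y (Pi.single k (EuclideanSpace.single j (1 : ℝ)))) := by
    simp only [hΨ]
    rw [mul_sub, Finset.mul_sum, Finset.mul_sum, ← Finset.sum_sub_distrib]
    exact Finset.sum_congr rfl fun k _ => by ring
  rw [hΨw'] at hΨw
  exact sub_eq_zero.1 ((mul_eq_zero.1 hΨw).resolve_left I_ne_zero)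

end Literature.MathematicalPhysics.QuantumFieldTheory
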